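import Literature.MathematicalPhysics.QuantumLattice.HubbardRingExchangeDictionary
import Mathlib.Analysis.SpecialFunctions.Pow.Real
import Mathlib.Analysis.SpecialFunctions.Log.Basic

/-!
# Exchange–lattice exponents under compression: the area Grüneisen parameter `γ_A`, the bond-length exponent `n` of `J ∼ d^{−n}`, and the power-law bookkeeping of `J = 4t²/U`

The pressure / ion-size dependence of the in-plane superexchange of cuprate parents is reported as
TWO-POINT EXPONENTS: Mallett et al. «quantify the shift in `J` with Ln size using an area Grüneisen
parameter, `γ_A = −ln(J/J₀)/ln(A/A₀)`, where `A` is the basal area, `a × b`, of the unit cell», finding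
`γ_A = 3.0 ± 0.6` for LnBa₂Cu₃O₆ (internal pressure) and `γ_A = 3.1 ± 0.1` for La₂CuO₄ under external
pressure to 10 GPa [MallettEtAl2013, pp. 2–3]; Xin et al. write «the dependence of `J` is expressed
by a power law, `J ∼ d^{−n}`, where `d` is the in-plane Cu–O–Cu bonding length», quoting `n = 6.4 ± 0.8`
(La₂CuO₄), `3.0 ± 0.5` (Eu₂CuO₄, YBa₂Cu₃O₆.₂), `4 ± 2` (M₂CuO₄), `10.3` (Bi(Y)-2212), and measuring
`n = 6.6 ± 0.2` for the Bi₂Sr₂CaCu₂O₈ parent to 6 GPa [XinEtAl2023, p. 2 and abstract].  On the model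
side the leading-order one-band dictionary is `J = 4t²/U` [ColdeaEtAl2001, p. 3] (with the `t⁴/U³`
correction `J = 4t²/U − 24t⁴/U³ = (4t²/U)(1 − 6t²/U²)` of the companion file
`HubbardRingExchangeDictionary.lean`), and the tight-binding distance law of the Cu–O matrix element
is `V_pdm = η_pdm ħ²√(r_p r_d³)/(m d⁴)`, i.e. `V_pd ∝ d^{−4}` (older solid-state-table form `∝ d^{−7/2}`)
[Harrison1999, Eq. (17-1)].

This file types the EXACT bookkeeping these statements are combined with — nothing about any
material is claimed:

* §1 the two printed two-point exponents as definitions and their relation: for a square basal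
  plane `A = d²` (more generally `A/A₀ = (d/d₀)²`) one has `n = 2γ_A` identically (`ln` of a square),
  so `γ_A = 3.1 ± 0.1 ↔ n = 6.2 ± 0.2`, `n = 6.6 ± 0.2 ↔ γ_A = 3.3 ± 0.1`, etc.;
* §2 if between the two states the quantity follows a power law `J/J₀ = (A/A₀)^{−γ}` then `γ_A = γ`
  (and likewise for `n`), i.e. the two-point exponent IS the power-law exponent;
* §3 power laws compose: with `t = t₀ a^{−η_t}`, `U = U₀ a^{−η_U}` (`a > 0`) the dictionary value
  `4t²/U` equals `(4t₀²/U₀) a^{−(2η_t − η_U)}` — the exponent budget `η_J = 2η_t − η_U`, hence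
  `η_U = 2η_t − η_J`, monotone (antitone) in `η_J`; powers of the printed `d^{−4}` matrix-element law
  carry exponents `4m` (`V_pd² ∝ d^{−8}`, `V_pd⁴ ∝ d^{−16}`);
* §4 the `t⁴`-corrected coupling is NOT a power law: `J(a) = (4t²/U)(1 − 6t²/U²)`, so the ratio of two
  states is the power-law ratio times `(1 − 6x₂)/(1 − 6x₁)`, `x = t²/U²` (exact algebra on `scJ1`).

References: B. P. P. Mallett et al., Phys. Rev. Lett. 111 (2013) 237001, arXiv:1202.5078, pp. 2–3;
J. Xin et al., arXiv:2304.11311 (2023), p. 2; R. Coldea et al., Phys. Rev. Lett. 86 (2001) 5377, p. 3;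
W. A. Harrison, *Elementary Electronic Structure* (World Scientific, 1999), Eq. (17-1).
AI-produced formalisation (H21, cell hubbard-downfold, seat lit-2, 2026-08-27); no facts, no
axioms beyond Mathlib's, no `sorry`.
-/

namespace Literature.MathematicalPhysics.QuantumLattice

open Real

noncomputable section

/-! ## 1. The two printed two-point exponents and `n = 2γ_A` -/

/-- Mallett's area Grüneisen parameter of the exchange between two states `(J, A)` and `(J₀, A₀)`:
`γ_A = −ln(J/J₀)/ln(A/A₀)`, `A` = basal area `a × b`. [cite: MallettEtAl2013, p. 2] -/
def areaGruneisen (J J₀ A A₀ : ℝ) : ℝ := -Real.log (J / J₀) / Real.log (A / A₀)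

/-- The bond-length exponent `n` of «`J ∼ d^{−n}`» read between two states `(J, d)` and `(J₀, d₀)`:
`n = −ln(J/J₀)/ln(d/d₀)`. [cite: XinEtAl2023, p. 2] -/
def lengthExponent (J J₀ d d₀ : ℝ) : ℝ := -Real.log (J / J₀) / Real.log (d / d₀)

/-- Unfolding. [cite: MallettEtAl2013, p. 2] -/
theorem areaGruneisen_def (J J₀ A A₀ : ℝ) :
    areaGruneisen J J₀ A A₀ = -Real.log (J / J₀) / Real.log (A / A₀) := rfl

/-- Unfolding. [cite: XinEtAl2023, p. 2] -/
theorem lengthExponent_def (J J₀ d d₀ : ℝ) :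
    lengthExponent J J₀ d d₀ = -Real.log (J / J₀) / Real.log (d / d₀) := rfl

/-- **`n = 2γ_A` for a square basal plane** (`A = d²`, `A₀ = d₀²`): `ln(d²/d₀²) = 2 ln(d/d₀)`, so the
length exponent is twice the area Grüneisen parameter — identically, with no hypothesis (both sides
are `0` in the degenerate case `ln(d/d₀) = 0`). [cite: MallettEtAl2013, p. 2] -/
theorem lengthExponent_eq_two_mul_areaGruneisen_sq (J J₀ d d₀ : ℝ) :
    lengthExponent J J₀ d d₀ = 2 * areaGruneisen J J₀ (d ^ 2) (d₀ ^ 2) := by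
  rw [lengthExponent, areaGruneisen, ← div_pow, Real.log_pow]
  push_cast
  by_cases hl : Real.log (d / d₀) = 0
  · rw [hl]; simp
  · field_simp

/-- The same with a rectangular basal plane scaled isotropically, `A/A₀ = (d/d₀)²` as a hypothesis
(`A₀ ≠ 0`). [cite: MallettEtAl2013, p. 2] -/
theorem lengthExponent_eq_two_mul_areaGruneisen {J J₀ d d₀ A A₀ : ℝ}
    (h : A / A₀ = (d / d₀) ^ 2) :
    lengthExponent J J₀ d d₀ = 2 * areaGruneisen J J₀ A A₀ := by
  rw [lengthExponent, areaGruneisen, h, Real.log_pow]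
  push_cast
  by_cases hl : Real.log (d / d₀) = 0
  · rw [hl]; simp
  · field_simp

/-- The printed pairs as numbers: `γ_A = 3.1 ± 0.1` (La₂CuO₄, external pressure) ↔ `n = 6.2 ± 0.2`;
`γ_A = 3.0 ± 0.6` (Ln123, internal pressure) ↔ `n = 6.0 ± 1.2`. [cite: MallettEtAl2013, pp. 2–3] -/
theorem mallett2013_n_of_gammaA :
    2 * (3.1 : ℝ) = 6.2 ∧ 2 * (0.1 : ℝ) = 0.2 ∧ 2 * (3.0 : ℝ) = 6.0 ∧ 2 * (0.6 : ℝ) = 1.2 := by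
  norm_num

/-- … and conversely `n = 6.6 ± 0.2` (Bi₂Sr₂CaCu₂O₈ parent) ↔ `γ_A = 3.3 ± 0.1`, `n = 6.4 ± 0.8`
(La₂CuO₄, as quoted) ↔ `γ_A = 3.2 ± 0.4`, `n = 3.0 ± 0.5` ↔ `γ_A = 1.5 ± 0.25`.
[cite: XinEtAl2023, p. 2] -/
theorem xin2023_gammaA_of_n :
    (6.6 : ℝ) / 2 = 3.3 ∧ (0.2 : ℝ) / 2 = 0.1 ∧ (6.4 : ℝ) / 2 = 3.2 ∧ (0.8 : ℝ) / 2 = 0.4 ∧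
      (3.0 : ℝ) / 2 = 1.5 ∧ (0.5 : ℝ) / 2 = 0.25 := by
  norm_num

/-! ## 2. A power law between the two states has two-point exponent equal to its exponent -/

/-- If `J/J₀ = (A/A₀)^{−γ}` with `A/A₀ > 0`, `A/A₀ ≠ 1`, then `γ_A = γ`. [cite: MallettEtAl2013, p. 2] -/
theorem areaGruneisen_of_powerLaw {J J₀ A A₀ γ : ℝ} (hA : 0 < A / A₀) (hA₁ : A / A₀ ≠ 1)
    (h : J / J₀ = (A / A₀) ^ (-γ)) : areaGruneisen J J₀ A A₀ = γ := by
  rw [areaGruneisen, h, Real.log_rpow hA]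
  have hl : Real.log (A / A₀) ≠ 0 := Real.log_ne_zero_of_pos_of_ne_one hA hA₁
  field_simp

/-- If `J/J₀ = (d/d₀)^{−n}` with `d/d₀ > 0`, `d/d₀ ≠ 1`, then the length exponent is `n`.
[cite: XinEtAl2023, p. 2] -/
theorem lengthExponent_of_powerLaw {J J₀ d d₀ n : ℝ} (hd : 0 < d / d₀) (hd₁ : d / d₀ ≠ 1)
    (h : J / J₀ = (d / d₀) ^ (-n)) : lengthExponent J J₀ d d₀ = n := by
  rw [lengthExponent, h, Real.log_rpow hd]
  have hl : Real.log (d / d₀) ≠ 0 := Real.log_ne_zero_of_pos_of_ne_one hd hd₁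
  field_simp

/-! ## 3. Power laws compose: `η_J = 2η_t − η_U` for `J = 4t²/U`; powers of `d^{−4}` -/

/-- A power law in the lattice parameter, `X(a) = X₀ a^{−η}` (`a > 0` intended).
[cite: XinEtAl2023, p. 2] -/
def powerLaw (X₀ η a : ℝ) : ℝ := X₀ * a ^ (-η)

/-- Unfolding. [cite: XinEtAl2023, p. 2] -/
theorem powerLaw_def (X₀ η a : ℝ) : powerLaw X₀ η a = X₀ * a ^ (-η) := rfl

/-- `(a^{−η})^m = a^{−mη}` (`a ≥ 0`, `m : ℕ`). [folklore] -/
private lemma rpow_neg_pow {a : ℝ} (ha : 0 ≤ a) (η : ℝ) (m : ℕ) :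
    (a ^ (-η)) ^ m = a ^ (-((m : ℝ) * η)) := by
  rw [← Real.rpow_natCast, ← Real.rpow_mul ha]
  ring_nf

/-- Powers of a power law: `X(a)^m = X₀^m a^{−mη}` — e.g. the printed `V_pd ∝ d^{−4}` gives
`V_pd² ∝ d^{−8}`, `V_pd⁴ ∝ d^{−16}`. [cite: Harrison1999, Eq. (17-1)] -/
theorem powerLaw_pow {a : ℝ} (ha : 0 < a) (X₀ η : ℝ) (m : ℕ) :
    powerLaw X₀ η a ^ m = powerLaw (X₀ ^ m) ((m : ℝ) * η) a := by
  rw [powerLaw, powerLaw, mul_pow, rpow_neg_pow ha.le]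

/-- Harrison's matrix-element law read as exponents: `(d^{−4})² = d^{−8}`, `(d^{−4})⁴ = d^{−16}`;
for the older `d^{−7/2}` form `(d^{−7/2})² = d^{−7}`, `(d^{−7/2})⁴ = d^{−14}` (`d > 0`).
[cite: Harrison1999, Eq. (17-1)] -/
theorem harrison1999_pd_exponents {d : ℝ} (hd : 0 < d) (V₀ : ℝ) :
    powerLaw V₀ 4 d ^ 2 = powerLaw (V₀ ^ 2) 8 d ∧ powerLaw V₀ 4 d ^ 4 = powerLaw (V₀ ^ 4) 16 d ∧
      powerLaw V₀ (7 / 2) d ^ 2 = powerLaw (V₀ ^ 2) 7 d ∧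
      powerLaw V₀ (7 / 2) d ^ 4 = powerLaw (V₀ ^ 4) 14 d := by
  refine ⟨?_, ?_, ?_, ?_⟩ <;> rw [powerLaw_pow hd] <;> norm_num

/-- Quotient of power laws: `X(a)/Y(a) = (X₀/Y₀) a^{−(η_X − η_Y)}` (`a > 0`). [cite: XinEtAl2023, p. 2] -/
theorem powerLaw_div {a : ℝ} (ha : 0 < a) (X₀ Y₀ ηX ηY : ℝ) :
    powerLaw X₀ ηX a / powerLaw Y₀ ηY a = powerLaw (X₀ / Y₀) (ηX - ηY) a := by
  rw [powerLaw, powerLaw, powerLaw, show -(ηX - ηY) = -ηX - -ηY by ring, Real.rpow_sub ha]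
  have hY : a ^ (-ηY) ≠ 0 := (Real.rpow_pos_of_pos ha _).ne'
  field_simp

/-- Product of power laws: `X(a)·Y(a) = (X₀Y₀) a^{−(η_X + η_Y)}` (`a > 0`). [cite: XinEtAl2023, p. 2] -/
theorem powerLaw_mul {a : ℝ} (ha : 0 < a) (X₀ Y₀ ηX ηY : ℝ) :
    powerLaw X₀ ηX a * powerLaw Y₀ ηY a = powerLaw (X₀ * Y₀) (ηX + ηY) a := by
  rw [powerLaw, powerLaw, powerLaw, show -(ηX + ηY) = -ηX + -ηY by ring, Real.rpow_add ha]
  ring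

/-- **The exponent budget of the leading-order dictionary**: with `t = t₀ a^{−η_t}` and
`U = U₀ a^{−η_U}` (`a > 0`), `4t²/U = (4t₀²/U₀) a^{−(2η_t − η_U)}`, i.e. `η_J = 2η_t − η_U`.
[cite: ColdeaEtAl2001, p. 3] -/
theorem superexchange_powerLaw {a : ℝ} (ha : 0 < a) (t₀ U₀ ηt ηU : ℝ) :
    4 * powerLaw t₀ ηt a ^ 2 / powerLaw U₀ ηU a = powerLaw (4 * t₀ ^ 2 / U₀) (2 * ηt - ηU) a := by
  rw [powerLaw_pow ha, show (4 : ℝ) * powerLaw (t₀ ^ 2) (((2 : ℕ) : ℝ) * ηt) a =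
      powerLaw (4 * t₀ ^ 2) (2 * ηt) a by rw [powerLaw, powerLaw]; push_cast; ring,
    powerLaw_div ha]

/-- So a measured `η_J` and a model `η_t` fix `η_U = 2η_t − η_J` (the bookkeeping identity).
[cite: ColdeaEtAl2001, p. 3] -/
theorem etaU_of_budget {ηt ηU ηJ : ℝ} (h : ηJ = 2 * ηt - ηU) : ηU = 2 * ηt - ηJ := by
  linarith

/-- … as a BRACKET: `η_J ∈ [j₁, j₂]` at fixed `η_t` gives `η_U = 2η_t − η_J ∈ [2η_t − j₂, 2η_t − j₁]`
(antitone; independent error bars propagate as an interval, never averaged).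
[cite: MallettEtAl2013, p. 3] -/
theorem etaU_bracket {ηt ηJ j₁ j₂ : ℝ} (h : ηJ ∈ Set.Icc j₁ j₂) :
    2 * ηt - ηJ ∈ Set.Icc (2 * ηt - j₂) (2 * ηt - j₁) := by
  obtain ⟨h₁, h₂⟩ := h
  constructor <;> linarith

/-- The converse budget at FIXED `U` (`η_U = 0`): `η_J = 2η_t`; with the bare Harrison hopping law
`η_t ∈ {4, 7/2}` standing in for the one-band `η_t` this reads `η_J ∈ {8, 7}`, and with a hopping that
is itself a square of the matrix element (`η_t ∈ {8, 7}`) it reads `η_J ∈ {16, 14}` — the numbers the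
measured `n ≈ 6–6.8` is contrasted with. [cite: Harrison1999, Eq. (17-1)] -/
theorem fixedU_budgets :
    2 * (4 : ℝ) - 0 = 8 ∧ 2 * (7 / 2 : ℝ) - 0 = 7 ∧ 2 * (8 : ℝ) - 0 = 16 ∧ 2 * (7 : ℝ) - 0 = 14 := by
  norm_num

/-! ## 4. The `t⁴`-corrected coupling is not a power law: the exact two-state ratio -/

/-- `J = scJ1 t U = (4t²/U)(1 − 6(t/U)²)` (`U ≠ 0`), restated with the ratio `x = t²/U²`.
[cite: ColdeaEtAl2001, p. 3] -/
theorem scJ1_eq_leading_mul_correction {t U : ℝ} (hU : U ≠ 0) :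
    scJ1 t U = 4 * t ^ 2 / U * (1 - 6 * (t ^ 2 / U ^ 2)) := by
  rw [scJ1_eq_factor hU]
  field_simp

/-- Hence between two states the corrected couplings are in the ratio
`J₂/J₁ = [(4t₂²/U₂)/(4t₁²/U₁)] · (1 − 6x₂)/(1 − 6x₁)`, `xᵢ = tᵢ²/Uᵢ²` (`Uᵢ ≠ 0`, `t₁ ≠ 0`;
at `1 − 6x₁ = 0` both sides are `0` by the division convention): the power-law ratio of §3 times a correction factor that is itself state dependent.
[cite: ColdeaEtAl2001, p. 3] -/
theorem scJ1_ratio {t₁ U₁ t₂ U₂ : ℝ} (hU₁ : U₁ ≠ 0) (hU₂ : U₂ ≠ 0) (ht₁ : t₁ ≠ 0) :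
    scJ1 t₂ U₂ / scJ1 t₁ U₁ =
      (4 * t₂ ^ 2 / U₂) / (4 * t₁ ^ 2 / U₁) * ((1 - 6 * (t₂ ^ 2 / U₂ ^ 2)) / (1 - 6 * (t₁ ^ 2 / U₁ ^ 2))) := by
  rw [scJ1_eq_leading_mul_correction hU₁, scJ1_eq_leading_mul_correction hU₂]
  have h4 : 4 * t₁ ^ 2 / U₁ ≠ 0 := by positivity
  field_simp

/-- Size of the correction factor at the cuprate ratio `U/t = 8`: `x = 1/64`, `1 − 6x = 29/32`, and
`6x/(1 − 6x) = 3/29 ∈ (0.103, 0.104)`. [cite: ColdeaEtAl2001, p. 3] -/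
theorem correction_at_U_over_t_eight :
    1 - 6 * ((1 : ℝ) ^ 2 / 8 ^ 2) = 29 / 32 ∧ (0.103 : ℝ) < 3 / 29 ∧ (3 : ℝ) / 29 < 0.104 ∧
      6 * ((1 : ℝ) ^ 2 / 8 ^ 2) / (1 - 6 * ((1 : ℝ) ^ 2 / 8 ^ 2)) = 3 / 29 := by
  norm_num

end

end Literature.MathematicalPhysics.QuantumLattice
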